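import Mathlib
import HarnessLib
import Summits.QuantumFields.YangMills.Theorems.PencilRigidityCurvatureKernelBoundTorusInfiniteVolumeComparison
import Summits.QuantumFields.YangMills.Theorems.PencilRigidityCurvatureKernelBoundLatticeSchwingerPairContinuity
import Summits.QuantumFields.YangMills.Theorems.PencilRigidityCurvatureKernelBoundFiniteCouplingStrongTempered
import Summits.QuantumFields.YangMills.Theorems.PencilRigidityCurvatureKernelBoundSwapHankelDecay
import Summits.QuantumFields.YangMills.Theorems.PencilRigidityCurvatureKernelBoundSwapDiagonalVanishingLemmas
import Literature.MathematicalPhysics.QuantumLattice.SchwartzTranslationCutoff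
import Literature.MathematicalPhysics.QuantumFieldTheory.YangMillsOS

/-!
# `CurvatureKernelBound` — brick `SwapDiagonalVanishing` of lead c10's swap-mirror programme toward
# `Stub.FiniteCouplingStrongSubextensive` (crux stmt-QuantumFields-11687, line `coupling-trichotomy`, skeleton v9, wave 3)

**The endgame of the swap-mirror programme.** Along a scaling scheme `sch` (spacing `a_k → 0`, box
half-side `L_k` with `a_k L_k → ∞`, couplings `0 ≤ β_k ≤ β' < β₁/4` eventually, renormalisation
`c_k`), under the convergence clause of `W₁` (`hconv`), the sub-extensive rate
`c_k² e^{−κ(L_k − T/a_k)} → 0`, the infinite-volume box limits `q`, `P` of the free-boundary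
strong-coupling state with exponential clustering (hypothesis `hF5`, the conclusion of
`InfiniteVolumeCurvatureClustering`), the quantitative finite-size rate (hypothesis `hFS`, the conclusion
of `TorusFiniteSizeRate`) and the swap-Hankel decay (hypothesis `hdecay`, the conclusion of
`SwapHankelDecay`: eventually in `k`, `E_k(u) ≤ E_k(0) e^{−2mu}` for every `u`, where
`E_k(u) = a_k⁸ ΣΣ g(a x) gθ(a y) (P(y − x − 2u v) − q²)`, `v = e₀ − e₁`), the truncated renormalised
lattice two-point function of the curvature at the fixed mirror pair `(gθ, g)`, `gθ = g ∘ swap₀₁`,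
`g` supported in `{δ ≤ z 0 − z 1} ∩ B̄(0, T)`, tends to `0`.

Proof. `T^T_k(gθ, g) → S^T` by `hconv` at `n = 2, 1` (disjoint supports in the closed half-spaces
`{z 0 − z 1 ≤ −δ}`, `{δ ≤ z 0 − z 1}`); by `TorusInfiniteVolumeComparison` and the rate,
`c_k² E_k(0) → S^T` as well (symmetry of the double sum, evenness of `P`). With
`u_k → ∞`, `u_k a_k → 0` (`SwapDiagonal.exists_shift_seq`) and `h_k = g(· − 2u_k a_k v)`:
`c_k² E_k(u_k)` is the infinite-volume model at the pair `(gθ, h_k)` (reindexing the lattice sum),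
`h_k → g` in `𝓢` (strong continuity of translations) with supports in the fixed half-space, so
`T^T_k(gθ, h_k) → S^T` by `LatticeSchwingerPairContinuity` (the one-point factor is translation
invariant, `LatticeOneTranslate`), hence `c_k² E_k(u_k) → S^T`; finally
`0 ≤ c_k² E_k(u_k) ≤ c_k² E_k(0) e^{−2mu_k} → S^T · 0 = 0` — the SIGN of `E_k(u_k)` is reflection
positivity across the swap mirror, read off the landed brick `SwapHankelDecay` — so `S^T = 0`.
[folklore]
-/

noncomputable section

open scoped BigOperators Topology SchwartzMap
open MeasureTheory Filter Set
open Literature.MathematicalPhysics.QuantumLattice Literature.MathematicalPhysics.QuantumFieldTheory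
  Literature.MathematicalPhysics.AQFT Literature.Probability.LatticeModels

namespace Summit.QuantumFields.YangMills.Theorems.CurvatureKernel

/-- **Brick `SwapDiagonalVanishing`** (REGISTERED signature — do not change). Along the scheme, under
the convergence clause of `W₁`, the sub-extensive rate, the infinite-volume clustering data `q, P`,
the finite-size rate and the swap-Hankel decay `E_k(u) ≤ E_k(0) e^{−2mu}`, the truncated
renormalised lattice two-point function of the curvature at the fixed mirror pair `(g ∘ swap₀₁, g)`
tends to `0`. See the module docstring for the proof. [folklore] -/
theorem SwapDiagonalVanishing : open Literature.MathematicalPhysics.QuantumLattice Literature.MathematicalPhysics.AQFT Literature.MathematicalPhysics.QuantumFieldTheory Literature.Probability.LatticeModels in ∀ (G : Type) [Group G] [TopologicalSpace G] [IsTopologicalGroup G] [CompactSpace G] [MeasurableSpace G] [BorelSpace G] (r : LatticeRep G) (sch : SpeciesScheme (YMSpecies G)) (S₁ : SchwingerFamily (EuclideanSpace ℝ (Fin 4))), (∀ (n : ℕ), n ≠ 0 → ∀ (f : Fin n → SchwartzMap (EuclideanSpace ℝ (Fin 4)) ℝ) (F : SchwartzMap (Fin n → EuclideanSpace ℝ (Fin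 4)) ℂ), IsTensorOf F (fun i => ofRealTest (f i)) → IsOffDiagonal F → Filter.Tendsto (fun k : ℕ => ((latticeSchwinger r.ρ sch (fun s => s.F) k n (fun _ => r.curvature) f : ℝ) : ℂ)) Filter.atTop (nhds (S₁ n F))) → ∀ (β' : ℝ), 0 < β' → β' < betaOne 4 r.ρ / 4 → (∀ k, 0 ≤ sch.β k) → (∀ᶠ k in Filter.atTop, sch.β k ≤ β') → (∀ κ T : ℝ, 0 < κ → Filter.Tendsto (fun k : ℕ => sch.c r.curvature k ^ 2 * Real.exp (-(κ * ((sch.L k : ℝ) - T / sch.a k)))) Filter.atTop (nhds 0)) → ∀ (m A : ℝ) (q : ℝ → ℝ) (P : ℝ → Site 4 → ℝ), 0 < m → (∀ β : ℝ, 0 ≤ β → β ≤ β' → (∀ x : Site 4, HasBoxLimit (fun Λ => zdExpect r.ρ β Λ (r.curvature.F ∘ ZdGaugeConfig.translate x)) (q β)) ∧ (∀ x y : Site 4, HasBoxLimit (fun Λ => zdExpect r.ρ β Λ (fun U => r.curvature.F (ZdGaugeConfig.translate x U) * r.curvature.F (ZdGaugeConfig.translate y U))) (P β (y - x))) ∧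 ∀ z : Site 4, |P β z - q β ^ 2| ≤ A * Real.exp (-(m * ‖z‖))) → ∀ (μ' : ℝ) (Afs : ℕ → ℝ), 0 < μ' → (∀ (n : ℕ) (B : Finset (Literature.MathematicalPhysics.QuantumLattice.ZdEdge 4)) (R : ℕ), B.card ≤ n → (∀ e ∈ B, e.1 ∈ box 4 R) → ∀ (F : ZdGaugeConfig 4 G → ℝ), Measurable F → (∀ U, |F U| ≤ 1) → DependsOn F (B : Set (Literature.MathematicalPhysics.QuantumLattice.ZdEdge 4)) → ∀ (β gβ : ℝ), |β| < betaOne 4 r.ρ / 4 → HasBoxLimit (fun Λ => zdExpect r.ρ β Λ F) gβ → ∀ L : ℕ, R < L → |wilsonExpectation (d := 4) (L := 2 * L + 1) r.ρ β (toTorusObservable (2 * L + 1) F) - gβ| ≤ Afs n * Real.exp (-(μ' * ((L : ℝ) - R)))) → ∀ (δ T : ℝ) (g gθ : SchwartzMap (EuclideanSpace ℝ (Fin 4)) ℝ), 0 < δ → 0 < T → (∀ z ∈ tsupport (g : EuclideanSpace ℝ (Fin 4) → ℝ), δ ≤ z 0 - z 1) → tsupport (g : EuclideanSpace ℝ (Fin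 4) → ℝ) ⊆ Metric.closedBall 0 T → (∀ z : EuclideanSpace ℝ (Fin 4), gθ z = g (WithLp.toLp 2 (fun i => z (Equiv.swap (0 : Fin 4) 1 i)))) → (∀ᶠ k in Filter.atTop, ∀ u : ℕ, sch.a k ^ 8 * ∑ x ∈ box 4 (sch.L k), ∑ y ∈ box 4 (sch.L k), g (sch.a k • siteToE x) * gθ (sch.a k • siteToE y) * (P (sch.β k) (y - x - ((2 * u : ℕ) : ℤ) • (Pi.single 0 (1 : ℤ) - Pi.single 1 (1 : ℤ) : Site 4)) - q (sch.β k) ^ 2) ≤ (sch.a k ^ 8 * ∑ x ∈ box 4 (sch.L k), ∑ y ∈ box 4 (sch.L k), g (sch.a k • siteToE x) * gθ (sch.a k • siteToE y) * (P (sch.β k) (y - x) - q (sch.β k) ^ 2)) * Real.exp (-(2 * m * u))) → Filter.Tendsto (fun k : ℕ => latticeSchwinger r.ρ sch (fun s => s.F) k 2 (fun _ => r.curvature) ![gθ, g] - latticeSchwinger r.ρ sch (fun s => s.F) k 1 (fun _ => r.curvature) (fun _ => gθ) * latticeSchwinger r.ρ sch (fun s => s.F) k 1 (fun _ => r.curvature)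 (fun _ => g)) Filter.atTop (nhds 0) := by
  intro G _ _ _ _ _ _ r sch S₁ hconv β' hβ'0 hβ'1 hβnn hβev hrate m A q P hm hF5 μ' Afs hμ' hFS δ T g gθ
    hδ hT hg hgT hθ hdecay
  have ha0 : ∀ k, 0 < sch.a k := sch.a_pos
  haveI : T2Space G := (r.continuous.isClosedEmbedding r.injective).isEmbedding.t2Space
  haveI : SecondCountableTopology G :=
    (r.continuous.isClosedEmbedding r.injective).isEmbedding.secondCountableTopology
  /- §1 supports and bounds of the fixed test functions -/
  obtain ⟨Mg, hMg⟩ := exists_abs_le_schwartz g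
  have hθsupp := SwapDiagonal.tsupport_swap_subset hg hgT hθ
  have hθK : tsupport (gθ : EuclideanSpace ℝ (Fin 4) → ℝ) ⊆
      {z : EuclideanSpace ℝ (Fin 4) | z 0 - z 1 ≤ -δ} := fun z hz => (hθsupp hz).1
  have hθT : tsupport (gθ : EuclideanSpace ℝ (Fin 4) → ℝ) ⊆ Metric.closedBall 0 T :=
    fun z hz => (hθsupp hz).2
  have hgK : tsupport (g : EuclideanSpace ℝ (Fin 4) → ℝ) ⊆
      {z : EuclideanSpace ℝ (Fin 4) | δ ≤ z 0 - z 1} := fun z hz => hg z hz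
  have hθM : ∀ z, |gθ z| ≤ Mg := fun z => by
    rw [hθ]
    exact hMg _
  have hK₀c : IsClosed {z : EuclideanSpace ℝ (Fin 4) | z 0 - z 1 ≤ -δ} :=
    isClosed_le SwapDiagonal.continuous_coord_sub continuous_const
  have hK₁c : IsClosed {z : EuclideanSpace ℝ (Fin 4) | δ ≤ z 0 - z 1} :=
    isClosed_le continuous_const SwapDiagonal.continuous_coord_sub
  have hdisj : Disjoint {z : EuclideanSpace ℝ (Fin 4) | z 0 - z 1 ≤ -δ}
      {z : EuclideanSpace ℝ (Fin 4) | δ ≤ z 0 - z 1} := by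
    rw [Set.disjoint_left]
    intro z h0 h1
    simp only [Set.mem_setOf_eq] at h0 h1
    linarith
  /- §2 the shift sequence and the translated test functions `h k = g(· − w k)` -/
  obtain ⟨u, hu, hua⟩ := SwapDiagonal.exists_shift_seq sch.a sch.a_pos sch.tendsto_a
  obtain ⟨v, hv⟩ : ∃ v : Site 4, v = Pi.single 0 (1 : ℤ) - Pi.single 1 (1 : ℤ) := ⟨_, rfl⟩
  obtain ⟨s, hs⟩ : ∃ s : ℕ → Site 4, ∀ k, s k = ((2 * u k : ℕ) : ℤ) • v := ⟨_, fun _ => rfl⟩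
  obtain ⟨w, hw⟩ : ∃ w : ℕ → EuclideanSpace ℝ (Fin 4), ∀ k, w k = sch.a k • siteToE (s k) :=
    ⟨_, fun _ => rfl⟩
  obtain ⟨h, hh⟩ : ∃ h : ℕ → 𝓢(EuclideanSpace ℝ (Fin 4), ℝ),
      ∀ k, h k = SchwartzMap.compSubConstCLM ℝ (w k) g := ⟨_, fun _ => rfl⟩
  have h_apply : ∀ k z, h k z = g (z - w k) := fun k z => by
    rw [hh, SchwartzMap.compSubConstCLM_apply]
  have hsub : ∀ x y : Site 4, siteToE (x - y) = siteToE x - siteToE y := fun x y => by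
    ext i
    simp [siteToE_apply]
  have h_lat : ∀ k (y : Site 4), h k (sch.a k • siteToE y) = g (sch.a k • siteToE (y - s k)) := by
    intro k y
    rw [h_apply, hw, ← smul_sub, ← hsub]
  have hw' : ∀ k, w k = (sch.a k * (2 * (u k : ℝ))) • siteToE v := by
    intro k
    rw [hw, hs, SwapDiagonal.siteToE_zsmul, smul_smul]
    congr 1
    push_cast
    ring
  have hv0 : v 0 = 1 := by rw [hv]; simp
  have hv1 : v 1 = -1 := by rw [hv]; simp
  have hwi : ∀ k (i : Fin 4), w k i = sch.a k * (2 * (u k : ℝ)) * (v i : ℝ) := by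
    intro k i
    rw [hw', PiLp.smul_apply, siteToE_apply, smul_eq_mul]
  have hw01 : ∀ k, 0 ≤ w k 0 - w k 1 := fun k => by
    rw [hwi, hwi, hv0, hv1]
    push_cast
    nlinarith [(ha0 k).le, (u k).cast_nonneg (α := ℝ)]
  have hw_lim : Tendsto w atTop (𝓝 0) := by
    have h1 : Tendsto (fun k => sch.a k * (2 * (u k : ℝ))) atTop (𝓝 0) := by
      have h2 := hua.const_mul 2
      rw [mul_zero] at h2
      exact h2.congr fun k => by ring
    have h3 := h1.smul_const (siteToE v)
    rw [zero_smul] at h3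
    exact h3.congr fun k => (hw' k).symm
  have hw_norm : ∀ᶠ k in atTop, ‖w k‖ ≤ 1 :=
    ((tendsto_norm_zero.comp hw_lim).eventually (Iic_mem_nhds one_pos)).mono fun k hk => hk
  have hh_lim : Tendsto h atTop (𝓝 g) := by
    have h1 := ((continuous_compSubConstCLM ℝ g).tendsto 0).comp hw_lim
    have e0 : SchwartzMap.compSubConstCLM ℝ (0 : EuclideanSpace ℝ (Fin 4)) g = g := by
      ext z
      simp
    rw [e0] at h1
    refine h1.congr fun k => ?_
    rw [Function.comp_apply, hh]
  have hhK : ∀ k, tsupport (h k : EuclideanSpace ℝ (Fin 4) → ℝ) ⊆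
      {z : EuclideanSpace ℝ (Fin 4) | δ ≤ z 0 - z 1} := fun k => by
    rw [hh]
    exact SwapDiagonal.tsupport_translate_subset_halfSpace hg (w k) (hw01 k)
  have hhT : ∀ᶠ k in atTop, tsupport (h k : EuclideanSpace ℝ (Fin 4) → ℝ) ⊆
      Metric.closedBall 0 (T + 1) := hw_norm.mono fun k hk => by
    rw [hh]
    exact (SwapDiagonal.tsupport_translate_subset_closedBall hgT (w k)).trans
      (Metric.closedBall_subset_closedBall (by linarith))
  have hhM : ∀ k z, |h k z| ≤ Mg := fun k z => by
    rw [h_apply]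
    exact hMg _
  /- §3 the convergence clause at the fixed pair, at the moving pair, and at degree one -/
  have hconv2 : ∀ (f : Fin 2 → 𝓢(EuclideanSpace ℝ (Fin 4), ℝ))
      (F : 𝓢((Fin 2 → EuclideanSpace ℝ (Fin 4)), ℂ)), IsTensorOf F (fun i => ofRealTest (f i)) →
      IsOffDiagonal F → Tendsto (fun k : ℕ => ((latticeSchwinger r.ρ sch (fun s => s.F) k 2
        (fun _ => r.curvature) f : ℝ) : ℂ)) atTop (𝓝 (S₁ 2 F)) :=
    fun f F hF hoff => hconv 2 two_ne_zero f F hF hoff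
  have hF2t := isTensorOf_tensorFin (fun i => ofRealTest (![gθ, g] i))
  have hF2off : IsOffDiagonal (SchwartzMap.tensorFin 2 fun i => ofRealTest (![gθ, g] i)) :=
    PairContinuity.isOffDiagonal_tensorFin_two
      (K := ![{z : EuclideanSpace ℝ (Fin 4) | z 0 - z 1 ≤ -δ},
        {z : EuclideanSpace ℝ (Fin 4) | δ ≤ z 0 - z 1}]) hdisj (φ := ![gθ, g]) fun i => by
      fin_cases i
      · exact hθK
      · exact hgK
  have hL2 := hconv2 ![gθ, g] _ hF2t hF2off
  have hL2' := LatticeSchwingerPairContinuity r sch S₁ {z : EuclideanSpace ℝ (Fin 4) | z 0 - z 1 ≤ -δ}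
    {z : EuclideanSpace ℝ (Fin 4) | δ ≤ z 0 - z 1} hK₀c hK₁c hdisj hconv2 (fun _ => gθ) h gθ g
    (fun _ => hθK) hhK tendsto_const_nhds hh_lim _ hF2t
  have hL0 := hconv 1 one_ne_zero (fun _ => gθ) (SchwartzMap.tensorFin 1 fun _ => ofRealTest gθ)
    (isTensorOf_tensorFin _) (SwapDiagonal.isOffDiagonal_fin_one _)
  have hL1 := hconv 1 one_ne_zero (fun _ => g) (SchwartzMap.tensorFin 1 fun _ => ofRealTest g)
    (isTensorOf_tensorFin _) (SwapDiagonal.isOffDiagonal_fin_one _)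
  /- §4 shorthand sequences -/
  obtain ⟨TT, hTT⟩ : ∃ TT : ℕ → ℝ, ∀ k, TT k =
      latticeSchwinger r.ρ sch (fun s => s.F) k 2 (fun _ => r.curvature) ![gθ, g] -
        latticeSchwinger r.ρ sch (fun s => s.F) k 1 (fun _ => r.curvature) (fun _ => gθ) *
          latticeSchwinger r.ρ sch (fun s => s.F) k 1 (fun _ => r.curvature) (fun _ => g) :=
    ⟨_, fun _ => rfl⟩
  obtain ⟨TT', hTT'⟩ : ∃ TT' : ℕ → ℝ, ∀ k, TT' k =
      latticeSchwinger r.ρ sch (fun s => s.F) k 2 (fun _ => r.curvature) ![gθ, h k] -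
        latticeSchwinger r.ρ sch (fun s => s.F) k 1 (fun _ => r.curvature) (fun _ => gθ) *
          latticeSchwinger r.ρ sch (fun s => s.F) k 1 (fun _ => r.curvature) (fun _ => h k) :=
    ⟨_, fun _ => rfl⟩
  obtain ⟨X, hX⟩ : ∃ X : ℕ → ℝ, ∀ k, X k = sch.c r.curvature k ^ 2 * (sch.a k ^ 8 *
      ∑ x ∈ box 4 (sch.L k), ∑ y ∈ box 4 (sch.L k), gθ (sch.a k • siteToE x) *
        g (sch.a k • siteToE y) * (P (sch.β k) (y - x) - q (sch.β k) ^ 2)) := ⟨_, fun _ => rfl⟩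
  obtain ⟨X', hX'⟩ : ∃ X' : ℕ → ℝ, ∀ k, X' k = sch.c r.curvature k ^ 2 * (sch.a k ^ 8 *
      ∑ x ∈ box 4 (sch.L k), ∑ y ∈ box 4 (sch.L k), gθ (sch.a k • siteToE x) *
        h k (sch.a k • siteToE y) * (P (sch.β k) (y - x) - q (sch.β k) ^ 2)) := ⟨_, fun _ => rfl⟩
  obtain ⟨E, hE⟩ : ∃ E : ℕ → Site 4 → ℝ, ∀ k t, E k t = sch.a k ^ 8 *
      ∑ x ∈ box 4 (sch.L k), ∑ y ∈ box 4 (sch.L k), g (sch.a k • siteToE x) *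
        gθ (sch.a k • siteToE y) * (P (sch.β k) (y - x - t) - q (sch.β k) ^ 2) :=
    ⟨_, fun _ _ => rfl⟩
  obtain ⟨E0, hE0⟩ : ∃ E0 : ℕ → ℝ, ∀ k, E0 k = sch.a k ^ 8 *
      ∑ x ∈ box 4 (sch.L k), ∑ y ∈ box 4 (sch.L k), g (sch.a k • siteToE x) *
        gθ (sch.a k • siteToE y) * (P (sch.β k) (y - x) - q (sch.β k) ^ 2) := ⟨_, fun _ => rfl⟩
  obtain ⟨Kc, hKc⟩ := TorusInfiniteVolumeComparison G r sch μ' Afs hμ' hFS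
  obtain ⟨C, hC⟩ : ∃ C : ℝ, C = Mg * (2 * (T + 1) + 1) ^ 4 := ⟨_, rfl⟩
  obtain ⟨B, hB⟩ : ∃ B : ℕ → ℝ, ∀ k, B k = sch.c r.curvature k ^ 2 *
      Real.exp (-(μ' * ((sch.L k : ℝ) - (T + 3) / sch.a k))) * (|Kc| * C * C) := ⟨_, fun _ => rfl⟩
  /- §5 eventual geometry along the scheme -/
  have ha1 : ∀ᶠ k in atTop, sch.a k ≤ 1 :=
    (sch.tendsto_a.eventually (Iic_mem_nhds one_pos)).mono fun k hk => hk
  have hua1 : ∀ᶠ k in atTop, 2 * ((u k : ℝ) * sch.a k) ≤ 1 := by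
    have h2 := hua.const_mul 2
    rw [mul_zero] at h2
    exact (h2.eventually (Iic_mem_nhds one_pos)).mono fun k hk => hk
  have haL : ∀ᶠ k in atTop, T + 4 ≤ sch.a k * sch.L k := tendsto_atTop.1 sch.tendsto_L (T + 4)
  have haδ : ∀ᶠ k in atTop, sch.a k ≤ δ :=
    (sch.tendsto_a.eventually (Iic_mem_nhds hδ)).mono fun k hk => hk
  have hgeo : ∀ᶠ k in atTop, |sch.β k| < betaOne 4 r.ρ / 4 ∧ sch.β k ≤ β' ∧ sch.a k ≤ 1 ∧
      T / sch.a k + 2 < sch.L k ∧ (T + 1) / sch.a k + 2 < sch.L k ∧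
      T / sch.a k + 2 ≤ (T + 3) / sch.a k ∧ (T + 1) / sch.a k + 2 ≤ (T + 3) / sch.a k ∧
      (∀ y : Site 4, g (sch.a k • siteToE y) ≠ 0 → y ∈ box 4 (sch.L k) ∧ y + s k ∈ box 4 (sch.L k)) := by
    filter_upwards [hβev, ha1, hua1, haL] with k hβk ha1k hua1k haLk
    have hak := ha0 k
    have hinv : 1 ≤ 1 / sch.a k := by
      rw [le_div_iff₀ hak]
      linarith
    have hTa : 0 ≤ T / sch.a k := div_nonneg hT.le hak.le
    have hL4 : (T + 4) / sch.a k ≤ sch.L k := by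
      rw [div_le_iff₀' hak]
      exact haLk
    have e4 : (T + 4) / sch.a k = T / sch.a k + 4 * (1 / sch.a k) := by ring
    have e3 : (T + 3) / sch.a k = T / sch.a k + 3 * (1 / sch.a k) := by ring
    have e1 : (T + 1) / sch.a k = T / sch.a k + 1 * (1 / sch.a k) := by ring
    have hu2 : 2 * (u k : ℝ) ≤ 1 / sch.a k := by
      rw [le_div_iff₀ hak]
      linarith
    have hNat : ⌊T / sch.a k⌋₊ + 2 * u k ≤ sch.L k := by
      have h1 : (⌊T / sch.a k⌋₊ : ℝ) ≤ T / sch.a k := Nat.floor_le hTa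
      have h2 : (⌊T / sch.a k⌋₊ : ℝ) + 2 * u k ≤ sch.L k := by linarith
      exact_mod_cast h2
    refine ⟨by rw [abs_of_nonneg (hβnn k)]; linarith, hβk, ha1k, by linarith, by linarith,
      by linarith, by linarith, fun y hy => ?_⟩
    have hy' := mem_box_floor_of_apply_ne_zero hgT hak hy
    refine ⟨SwapDiagonal.mem_box_of_le hy' (le_trans (Nat.le_add_right _ _) hNat), ?_⟩
    rw [hs, hv]
    exact SwapDiagonal.add_shift_mem_box hy' hNat
  /- §6 per-step facts -/
  -- evenness of `P` on the good couplings
  have hPev : ∀ k, sch.β k ≤ β' → ∀ z, P (sch.β k) (-z) = P (sch.β k) z := fun k hβk =>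
    SwapDiagonal.even_of_hasBoxLimit (fun Λ F => zdExpect r.ρ (sch.β k) Λ F)
      (fun x U => r.curvature.F (ZdGaugeConfig.translate x U)) (P (sch.β k))
      (hF5 (sch.β k) (hβnn k) hβk).2.1
  -- (p3) the one-point function does not see the lattice translation
  have hp3 : ∀ᶠ k in atTop,
      latticeSchwinger r.ρ sch (fun s => s.F) k 1 (fun _ => r.curvature) (fun _ => h k) =
        latticeSchwinger r.ρ sch (fun s => s.F) k 1 (fun _ => r.curvature) (fun _ => g) :=
    hgeo.mono fun k hk => LatticeOneTranslate r sch k g (h k) (by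
      simp only [h_lat]
      exact SwapDiagonal.sum_translate_eq (φ := fun y => g (sch.a k • siteToE y)) (s k) hk.2.2.2.2.2.2.2)
  -- (p4) symmetry: the infinite-volume model at `(gθ, g)` is `c² E_k(0)`
  have hp4 : ∀ᶠ k in atTop, X k = sch.c r.curvature k ^ 2 * E0 k := hgeo.mono fun k hk => by
    rw [hX, hE0, SwapDiagonal.sum_sum_swap_even gθ g (P (sch.β k)) (q (sch.β k) ^ 2) (sch.a k)
      (box 4 (sch.L k)) (hPev k hk.2.1)]
  -- (p5) shift: the infinite-volume model at `(gθ, h k)` is `c² E_k(u_k)`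
  have hp5 : ∀ᶠ k in atTop, X' k = sch.c r.curvature k ^ 2 * E k (s k) := hgeo.mono fun k hk => by
    rw [hX', hE]
    simp only [h_lat]
    rw [SwapDiagonal.sum_sum_lattice_translate gθ g (P (sch.β k)) (q (sch.β k) ^ 2) (sch.a k)
      (box 4 (sch.L k)) (s k) hk.2.2.2.2.2.2.2 (hPev k hk.2.1)]
  -- (p6) the decay hypothesis at `u = u_k`, and the sign of `E_k(u_k)` (reflection positivity across
  -- the swap mirror: the landed brick `SwapHankelDecay`)
  have hp6 : ∀ᶠ k in atTop, 0 ≤ E k (s k) ∧ E k (s k) ≤ E0 k * Real.exp (-(2 * m * (u k : ℝ))) := by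
    filter_upwards [hdecay, hβev, haδ] with k hk hβk haδk
    rw [hE, hE0, hs, hv]
    exact ⟨(SwapHankelDecay G r β' m A q P hβ'0 hβ'1 hm hF5 (sch.β k) (hβnn k) hβk (sch.L k) (sch.a k) δ
      (ha0 k) haδk g gθ hg hθ (u k)).1, hk (u k)⟩
  -- (p1), (p2) torus versus infinite volume at the two pairs
  have hp1 : ∀ᶠ k in atTop, |TT k - X k| ≤ B k := by
    filter_upwards [hgeo] with k hk
    obtain ⟨hβabs, hβk, ha1k, hTL, -, he1, -, -⟩ := hk
    have hak := ha0 k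
    obtain ⟨hq, hP, -⟩ := hF5 (sch.β k) (hβnn k) hβk
    have hraw := hKc k (q (sch.β k)) (P (sch.β k)) hβabs hq hP T gθ g hT hθT hgT hTL
    rw [hTT, hX, hB]
    refine hraw.trans (SwapDiagonal.err_le (sq_nonneg _) (Real.exp_pos _).le
      (Real.exp_le_exp.2 (neg_le_neg (mul_le_mul_of_nonneg_left (by linarith) hμ'.le)))
      (by positivity) ?_ (by positivity) ?_)
    · rw [hC]
      exact SwapDiagonal.latticeSum_abs_le (by linarith)
        (hθT.trans (Metric.closedBall_subset_closedBall (by linarith))) hθM hak ha1k _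
    · rw [hC]
      exact SwapDiagonal.latticeSum_abs_le (by linarith)
        (hgT.trans (Metric.closedBall_subset_closedBall (by linarith))) hMg hak ha1k _
  have hp2 : ∀ᶠ k in atTop, |TT' k - X' k| ≤ B k := by
    filter_upwards [hgeo, hhT] with k hk hhTk
    obtain ⟨hβabs, hβk, ha1k, -, hTL1, -, he2, -⟩ := hk
    have hak := ha0 k
    obtain ⟨hq, hP, -⟩ := hF5 (sch.β k) (hβnn k) hβk
    have hraw := hKc k (q (sch.β k)) (P (sch.β k)) hβabs hq hP (T + 1) gθ (h k) (by linarith)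
      (hθT.trans (Metric.closedBall_subset_closedBall (by linarith))) hhTk hTL1
    rw [hTT', hX', hB]
    refine hraw.trans (SwapDiagonal.err_le (sq_nonneg _) (Real.exp_pos _).le
      (Real.exp_le_exp.2 (neg_le_neg (mul_le_mul_of_nonneg_left (by linarith) hμ'.le)))
      (by positivity) ?_ (by positivity) ?_)
    · rw [hC]
      exact SwapDiagonal.latticeSum_abs_le (by linarith)
        (hθT.trans (Metric.closedBall_subset_closedBall (by linarith))) hθM hak ha1k _
    · rw [hC]
      exact SwapDiagonal.latticeSum_abs_le (by linarith) hhTk (hhM k) hak ha1k _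
  /- §7 limits -/
  have hre : ∀ (x : ℕ → ℝ) (Z : ℂ), Tendsto (fun k => ((x k : ℝ) : ℂ)) atTop (𝓝 Z) →
      Tendsto x atTop (𝓝 Z.re) := fun x Z hx => by
    have h' := (Complex.continuous_re.tendsto Z).comp hx
    have ex : (Complex.re ∘ fun k => ((x k : ℝ) : ℂ)) = x := by
      funext k
      simp
    rwa [ex] at h'
  set sT : ℝ := (S₁ 2 (SchwartzMap.tensorFin 2 fun i => ofRealTest (![gθ, g] i)) -
    S₁ 1 (SchwartzMap.tensorFin 1 fun _ => ofRealTest gθ) *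
      S₁ 1 (SchwartzMap.tensorFin 1 fun _ => ofRealTest g)).re with hsT
  have hTTlim : Tendsto TT atTop (𝓝 sT) := by
    refine hre _ _ ((hL2.sub (hL0.mul hL1)).congr fun k => ?_)
    rw [hTT, Complex.ofReal_sub, Complex.ofReal_mul]
  have hL1' : Tendsto (fun k : ℕ => ((latticeSchwinger r.ρ sch (fun s => s.F) k 1
      (fun _ => r.curvature) (fun _ => h k) : ℝ) : ℂ)) atTop
      (𝓝 (S₁ 1 (SchwartzMap.tensorFin 1 fun _ => ofRealTest g))) :=
    hL1.congr' (hp3.mono fun k hk => by simp only [hk])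
  have hTT'lim : Tendsto TT' atTop (𝓝 sT) := by
    refine hre _ _ ((hL2'.sub (hL0.mul hL1')).congr fun k => ?_)
    rw [hTT', Complex.ofReal_sub, Complex.ofReal_mul]
  have hBlim : Tendsto B atTop (𝓝 0) := by
    have h1 := (hrate μ' (T + 3) hμ').mul_const (|Kc| * C * C)
    rw [zero_mul] at h1
    exact h1.congr fun k => (hB k).symm
  have hXlim : Tendsto X atTop (𝓝 sT) := by
    have hd : Tendsto (fun k => TT k - X k) atTop (𝓝 0) :=
      squeeze_zero_norm' (hp1.mono fun k hk => by rw [Real.norm_eq_abs]; exact hk) hBlim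
    have h1 := hTTlim.sub hd
    rw [sub_zero] at h1
    exact h1.congr fun k => by ring
  have hX'lim : Tendsto X' atTop (𝓝 sT) := by
    have hd : Tendsto (fun k => TT' k - X' k) atTop (𝓝 0) :=
      squeeze_zero_norm' (hp2.mono fun k hk => by rw [Real.norm_eq_abs]; exact hk) hBlim
    have h1 := hTT'lim.sub hd
    rw [sub_zero] at h1
    exact h1.congr fun k => by ring
  have hexp : Tendsto (fun k => Real.exp (-(2 * m * (u k : ℝ)))) atTop (𝓝 0) :=
    Real.tendsto_exp_neg_atTop_nhds_zero.comp (hu.const_mul_atTop (by positivity))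
  have hup : Tendsto (fun k => sch.c r.curvature k ^ 2 * E0 k * Real.exp (-(2 * m * (u k : ℝ))))
      atTop (𝓝 0) := by
    have h1 := (hXlim.congr' hp4).mul hexp
    rw [mul_zero] at h1
    exact h1
  have hsq : Tendsto (fun k => sch.c r.curvature k ^ 2 * E k (s k)) atTop (𝓝 0) :=
    tendsto_of_tendsto_of_tendsto_of_le_of_le' tendsto_const_nhds hup
      (hp6.mono fun k hk => mul_nonneg (sq_nonneg _) hk.1)
      (hp6.mono fun k hk => by
        rw [mul_assoc]
        exact mul_le_mul_of_nonneg_left hk.2 (sq_nonneg _))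
  have hsT0 : sT = 0 := tendsto_nhds_unique (hX'lim.congr' hp5) hsq
  have e : (fun k : ℕ => latticeSchwinger r.ρ sch (fun s => s.F) k 2 (fun _ => r.curvature) ![gθ, g] -
      latticeSchwinger r.ρ sch (fun s => s.F) k 1 (fun _ => r.curvature) (fun _ => gθ) *
        latticeSchwinger r.ρ sch (fun s => s.F) k 1 (fun _ => r.curvature) (fun _ => g)) = TT :=
    funext fun k => (hTT k).symm
  rw [e, ← hsT0]
  exact hTTlim

end Summit.QuantumFields.YangMills.Theorems.CurvatureKernel

end
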